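import Summits.ABC.ABC.Theses.FeketeScales
import Summits.ABC.ABC.Theorems.FeketeScalesSparseGoodScalesWindow
import Summits.ABC.ABC.Theorems.FeketeScalesSparseGoodScalesWieferich
import Summits.ABC.ABC.Theorems.FeketeScalesSparseGoodScalesMinimalResidue
import HarnessLib

/-!
# Lead c8 re-audit (2026-08-17): the logical position of the crux `SparseGoodScales`
# (stmt-ABC-2161) in the CURRENT tree, re-derived by the kernel (no new mathematics).

Each `example` below elaborates against the landed tree files only; together they say:
`ABC → SGS → (∀ q prime, infinitely many non-Wieferich primes base q)` and, in-route,
`ScaleSubmultiplicativity → (SGS ↔ ABC)`, `ScaleSubmultiplicativity → (DA∃ ↔ ABC)`.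
-/

set_option linter.dupNamespace false

namespace Summit.ABC.ABC.Cruxes.SparseGoodScales.LeadC8Audit

open Literature.NumberTheory.DiophantineGeometry
open Summit.ABC.ABC.Theses.FeketeScales

/-- Upper calibration: the summit implies the crux (landed p96117). -/
example : _root_.ABC → SparseGoodScales :=
  Summit.ABC.ABC.Theorems.sparseGoodScales_of_abc

/-- The Wieferich floor: the crux implies Silverman's abc-conclusion in every prime base
(landed p99695) — open unconditionally in every base. -/
example : SparseGoodScales → ∀ q : ℕ, q.Prime → {p : ℕ | p.Prime ∧ ¬ IsWieferich q p}.Infinite :=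
  Summit.ABC.ABC.Theorems.sparseGoodScales_imp_infinite_not_isWieferich

/-- In-route position: given the sister crux (stmt-ABC-2160, open) the crux IS the summit
(landed p96477). -/
example : ScaleSubmultiplicativity → (SparseGoodScales ↔ _root_.ABC) :=
  Summit.ABC.ABC.Theorems.sparseGoodScales_iff_abc_of_scaleSubmultiplicativity

/-- The picked line's composition (landed p111037): stub 1 → stub 2 → crux. -/
example : ScaleSubmultiplicativity →
    (∀ δ : ℝ, 0 < δ → ∃ Λ : ℝ, 1 < Λ ∧ ∀ N : ℕ, ∃ R : ℕ, N ≤ R ∧ ∀ a b c : ℕ,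
      IsABCTriple a b c → rad a b c ≤ R → (R : ℝ) < ((rad a b c : ℕ) : ℝ) ^ Λ →
        (c : ℝ) ≤ ((rad a b c : ℕ) : ℝ) ^ (1 + δ)) → SparseGoodScales :=
  Summit.ABC.ABC.Theorems.SparseGoodScales.sparseGoodScales_of_scaleSubmultiplicativity_of_droughts

end Summit.ABC.ABC.Cruxes.SparseGoodScales.LeadC8Audit
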